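import Mathlib
import HarnessLib
import HarnessLib.Audit

/-!
# SoloInformed — the chain function `G` and the harmonic-product identity of rational functions

Solo programme `solo-KontsevichZagierPeriods-informed`, session s47 (PROGRAMME XLVI, file 2;
pure algebra, no integrals).

For a list `Q = (Q₁, …, Q_k)` of reals (the CUMULATIVE block products `Q_r = B₁⋯B_r` of a
chain) put

  `G(Q) = (∏_{r<k} Q_r/(1 − Q_r)) · 1/(1 − Q_k)`,   `G(()) = 1`

(`soloInformedGQ`; for `0 < B_r < 1` this is the nested harmonic sum
`Σ_{n₁>n₂>⋯>n_k≥0} B₁^{n₁}⋯B_k^{n_k}`, and in cube coordinates it is the integrand `F_ε` of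
`SoloInformedCubeWord`).  A new letter of value `Y` can be INSERTED after position `i`
(`soloInformedInsQ Y p Q i = (Q₁,…,Q_i, Q_i·Y, Q_{i+1}Y, …, Q_kY)`, `Q₀ := p`) or MERGED into
block `i+1` (`soloInformedMergeQ Y Q i = (Q₁,…,Q_i, Q_{i+1}Y, …, Q_kY)`).  THE IDENTITY
(`soloInformed_harmonicGQ`):

  `1/(1 − Y) · G(Q) = Σ_{i=0}^{k} G(ins_i(Y; Q)) + Σ_{i=0}^{k-1} G(merge_i(Y; Q))`

for `0 ≤ Y < 1`, `0 ≤ Q_r < 1` — Hoffman's harmonic product `y_c ∗ (y_{b}w)` of a letter with a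
word, as an identity of rational functions.  It is proved by induction on `k` through the
`p`-deformed statement `soloInformed_harmonicGQ_aux` (the induction hypothesis is needed for the
TAIL chain `(Q₂,…,Q_k)`, whose "empty prefix" has value `Q₁`, not `1`), each step being
`field_simp; ring`.  Entry formulas for `ins`/`merge` (`…_getElem?_…`) are recorded for the
matching with cube representations in files 3–4.

References: Hoffman 1997 §2 (A1)–(A3); Hoffman 1992 §2; Zagier 1994 §9.
-/

noncomputable section

namespace Summit.KontsevichZagierPeriods.KontsevichZagierPeriods.Theorems

/-! ## 1. The chain function `G` -/

/-- The chain function `G(Q₁,…,Q_k) = (∏_{r<k} Q_r/(1−Q_r)) · 1/(1−Q_k)`, `G(()) = 1`. -/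
def soloInformedGQ : List ℝ → ℝ
  | [] => 1
  | [q] => 1 / (1 - q)
  | q :: q' :: t => q / (1 - q) * soloInformedGQ (q' :: t)

/-- `G(()) = 1`. -/
@[simp] theorem soloInformedGQ_nil : soloInformedGQ [] = 1 := rfl

/-- `G(q) = 1/(1−q)`. -/
@[simp] theorem soloInformedGQ_single (q : ℝ) : soloInformedGQ [q] = 1 / (1 - q) := rfl

/-- `G(q, q', …) = q/(1−q) · G(q', …)`. -/
@[simp] theorem soloInformedGQ_cons_cons (q q' : ℝ) (t : List ℝ) :
    soloInformedGQ (q :: q' :: t) = q / (1 - q) * soloInformedGQ (q' :: t) := rfl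

/-- `G(q :: t) = q/(1−q) · G(t)` for a nonempty tail. -/
theorem soloInformedGQ_cons {t : List ℝ} (ht : t ≠ []) (q : ℝ) :
    soloInformedGQ (q :: t) = q / (1 - q) * soloInformedGQ t := by
  obtain ⟨q', t', rfl⟩ := List.exists_cons_of_ne_nil ht
  rfl

/-- Product formula: `G(L ++ [q]) = (∏_{a ∈ L} a/(1−a)) · 1/(1−q)`. -/
theorem soloInformedGQ_append_single (L : List ℝ) (q : ℝ) :
    soloInformedGQ (L ++ [q]) = (L.map fun a => a / (1 - a)).prod * (1 / (1 - q)) := by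
  induction L with
  | nil => simp
  | cons a L ih =>
    rw [List.cons_append, soloInformedGQ_cons (by simp) a, ih, List.map_cons, List.prod_cons,
      mul_assoc]

/-- Product formula for a tuple: `G(f₀,…,f_k) = (∏_{r<k} f_r/(1−f_r)) · 1/(1−f_k)`. -/
theorem soloInformedGQ_ofFn {k : ℕ} (f : Fin (k + 1) → ℝ) :
    soloInformedGQ (List.ofFn f) =
      (∏ r : Fin k, f (Fin.castSucc r) / (1 - f (Fin.castSucc r))) * (1 / (1 - f (Fin.last k))) := by
  rw [List.ofFn_succ', List.concat_eq_append, soloInformedGQ_append_single, List.map_ofFn,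
    List.prod_ofFn]
  rfl

/-- `G(Q) > 0` when `0 < Q_r < 1`. -/
theorem soloInformedGQ_pos : ∀ (Q : List ℝ), (∀ q ∈ Q, 0 < q ∧ q < 1) → 0 < soloInformedGQ Q
  | [], _ => by simp
  | [q], h => by
    have := h q (by simp)
    rw [soloInformedGQ_single]
    exact one_div_pos.2 (by linarith)
  | q :: q' :: t, h => by
    have hq := h q (by simp)
    rw [soloInformedGQ_cons_cons]
    exact mul_pos (div_pos hq.1 (by linarith))
      (soloInformedGQ_pos (q' :: t) fun a ha => h a (List.mem_cons_of_mem q ha))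

/-! ## 2. Insertion and merging of a new letter -/

/-- `ins_i(Y; Q)` with empty-prefix value `p`:
`(Q₁,…,Q_i, Q_i·Y, Q_{i+1}·Y, …, Q_k·Y)` (`Q₀ = p`). -/
def soloInformedInsQ (Y : ℝ) : ℝ → List ℝ → ℕ → List ℝ
  | p, Q, 0 => (p * Y) :: Q.map (· * Y)
  | p, [], _ + 1 => [p * Y]
  | _, q :: t, i + 1 => q :: soloInformedInsQ Y q t i

/-- `merge_i(Y; Q) = (Q₁,…,Q_i, Q_{i+1}·Y, …, Q_k·Y)`. -/
def soloInformedMergeQ (Y : ℝ) : List ℝ → ℕ → List ℝ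
  | Q, 0 => Q.map (· * Y)
  | [], _ + 1 => []
  | q :: t, i + 1 => q :: soloInformedMergeQ Y t i

section lemmas

variable (Y : ℝ)

/-- `ins_0`. -/
@[simp] theorem soloInformedInsQ_zero (p : ℝ) (Q : List ℝ) :
    soloInformedInsQ Y p Q 0 = (p * Y) :: Q.map (· * Y) := by
  cases Q <;> rfl

/-- `ins_{i+1}` of the empty chain. -/
@[simp] theorem soloInformedInsQ_nil_succ (p : ℝ) (i : ℕ) :
    soloInformedInsQ Y p [] (i + 1) = [p * Y] := rfl

/-- `ins_{i+1}(q :: t) = q :: ins_i(t)` with new empty-prefix value `q`. -/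
@[simp] theorem soloInformedInsQ_cons_succ (p q : ℝ) (t : List ℝ) (i : ℕ) :
    soloInformedInsQ Y p (q :: t) (i + 1) = q :: soloInformedInsQ Y q t i := rfl

/-- `merge_0`. -/
@[simp] theorem soloInformedMergeQ_zero (Q : List ℝ) :
    soloInformedMergeQ Y Q 0 = Q.map (· * Y) := by
  cases Q <;> rfl

/-- `merge_{i+1}` of the empty chain. -/
@[simp] theorem soloInformedMergeQ_nil_succ (i : ℕ) : soloInformedMergeQ Y [] (i + 1) = [] := rfl

/-- `merge_{i+1}(q :: t) = q :: merge_i(t)`. -/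
@[simp] theorem soloInformedMergeQ_cons_succ (q : ℝ) (t : List ℝ) (i : ℕ) :
    soloInformedMergeQ Y (q :: t) (i + 1) = q :: soloInformedMergeQ Y t i := rfl

/-- `ins` is never empty. -/
theorem soloInformedInsQ_ne_nil : ∀ (p : ℝ) (Q : List ℝ) (i : ℕ), soloInformedInsQ Y p Q i ≠ []
  | p, Q, 0 => by simp
  | p, [], i + 1 => by simp
  | p, q :: t, i + 1 => by simp

/-- `merge` of a nonempty chain is nonempty. -/
theorem soloInformedMergeQ_ne_nil : ∀ {Q : List ℝ} (_ : Q ≠ []) (i : ℕ), soloInformedMergeQ Y Q i ≠ []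
  | [], h, _ => (h rfl).elim
  | q :: t, _, 0 => by simp
  | q :: t, _, i + 1 => by simp

/-- Length of `merge`. -/
theorem soloInformed_length_mergeQ : ∀ (Q : List ℝ) (i : ℕ),
    (soloInformedMergeQ Y Q i).length = Q.length
  | Q, 0 => by simp
  | [], i + 1 => by simp
  | q :: t, i + 1 => by simp [soloInformed_length_mergeQ t i]

/-- Length of `ins` (for `i ≤ k`). -/
theorem soloInformed_length_insQ : ∀ (p : ℝ) (Q : List ℝ) (i : ℕ),
    (soloInformedInsQ Y p Q i).length = Q.length + 1
  | p, Q, 0 => by simp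
  | p, [], i + 1 => by simp
  | p, q :: t, i + 1 => by simp [soloInformed_length_insQ q t i]

/-- **Entries of `merge`**: `merge_i(Q)[r] = Q_r` for `r < i` and `Q_r·Y` for `r ≥ i`. -/
theorem soloInformed_getElem?_mergeQ : ∀ (Q : List ℝ) (i r : ℕ),
    (soloInformedMergeQ Y Q i)[r]? = if r < i then Q[r]? else (Q[r]?).map (· * Y)
  | Q, 0, r => by simp
  | [], i + 1, r => by simp
  | q :: t, i + 1, 0 => by simp
  | q :: t, i + 1, r + 1 => by
    simp only [soloInformedMergeQ_cons_succ, List.getElem?_cons_succ, soloInformed_getElem?_mergeQ t i r,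
      Nat.succ_lt_succ_iff]

/-- **Entries of `ins`** (`i ≤ k`): `Q_r` for `r < i`, `Q_i·Y` (`Q₀ = p`) at `r = i`,
`Q_{r-1}·Y` for `r > i`. -/
theorem soloInformed_getElem?_insQ : ∀ (p : ℝ) (Q : List ℝ) (i r : ℕ), i ≤ Q.length →
    (soloInformedInsQ Y p Q i)[r]? =
      if r < i then Q[r]? else if r = i then some ((p :: Q).getD i 0 * Y)
        else (Q[r - 1]?).map (· * Y)
  | p, Q, 0, 0, _ => by simp
  | p, Q, 0, r + 1, _ => by simp
  | p, [], i + 1, r, h => by simp at h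
  | p, q :: t, i + 1, 0, _ => by simp
  | p, q :: t, i + 1, r + 1, h => by
    rw [soloInformedInsQ_cons_succ, List.getElem?_cons_succ,
      soloInformed_getElem?_insQ q t i r (by simpa using h)]
    simp only [Nat.succ_lt_succ_iff, Nat.succ_inj, List.getD_cons_succ, Nat.add_sub_cancel,
      List.getElem?_cons_succ]
    split_ifs with h1 h2
    · rfl
    · rfl
    · obtain ⟨r', rfl⟩ : ∃ r', r = r' + 1 := ⟨r - 1, by omega⟩
      simp

end lemmas

/-! ## 3. The harmonic-product identity -/

section identity

variable {Y : ℝ} (hY : 0 ≤ Y ∧ Y < 1)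
include hY

/-- **The `p`-deformed identity.** For `0 ≤ p ≤ 1`, `0 ≤ Q_r < 1`:
`Σ_{i≤k} G(ins_i^{(p)}) + Σ_{i<k} G(merge_i) = G(Q)/(1−Y) + (pY/(1−pY) − Y/(1−Y))·G(Q·Y)`.
(At `p = 1` the correction vanishes; the deformation is what the induction on `k` needs.) -/
theorem soloInformed_harmonicGQ_aux : ∀ (Q : List ℝ) (p : ℝ), (∀ q ∈ Q, 0 ≤ q ∧ q < 1) →
    0 ≤ p → p ≤ 1 →
    (∑ i ∈ Finset.range (Q.length + 1), soloInformedGQ (soloInformedInsQ Y p Q i)) +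
        ∑ i ∈ Finset.range Q.length, soloInformedGQ (soloInformedMergeQ Y Q i) =
      1 / (1 - Y) * soloInformedGQ Q +
        (p * Y / (1 - p * Y) - Y / (1 - Y)) * soloInformedGQ (Q.map (· * Y))
  | [], p, _, hp0, hp1 => by
    have h1 : 1 - Y ≠ 0 := by linarith
    have h2 : 1 - p * Y ≠ 0 := by nlinarith
    simp only [List.length_nil, zero_add, Finset.sum_range_one, soloInformedInsQ_zero, List.map_nil,
      soloInformedGQ_single, Finset.sum_range_zero, add_zero, soloInformedGQ_nil, mul_one]
    field_simp
    ring
  | q :: t, p, hQ, hp0, hp1 => by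
    have hq := hQ q (by simp)
    have ht : ∀ q' ∈ t, 0 ≤ q' ∧ q' < 1 := fun q' h => hQ q' (List.mem_cons_of_mem q h)
    have ih := soloInformed_harmonicGQ_aux t q ht hq.1 hq.2.le
    have h1 : 1 - Y ≠ 0 := by linarith
    have h2 : 1 - p * Y ≠ 0 := by nlinarith
    have h3 : 1 - q ≠ 0 := by linarith
    have h4 : 1 - q * Y ≠ 0 := by nlinarith
    -- peel off `i = 0` and factor `q/(1−q)` out of the rest
    have eI : ∀ i, soloInformedGQ (soloInformedInsQ Y p (q :: t) (i + 1)) =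
        q / (1 - q) * soloInformedGQ (soloInformedInsQ Y q t i) := fun i => by
      rw [soloInformedInsQ_cons_succ, soloInformedGQ_cons (soloInformedInsQ_ne_nil Y q t i)]
    have eM : ∀ i ∈ Finset.range t.length, soloInformedGQ (soloInformedMergeQ Y (q :: t) (i + 1)) =
        q / (1 - q) * soloInformedGQ (soloInformedMergeQ Y t i) := fun i hi => by
      have htne : t ≠ [] := by
        rintro rfl
        simp at hi
      rw [soloInformedMergeQ_cons_succ, soloInformedGQ_cons (soloInformedMergeQ_ne_nil Y htne i)]
    rw [List.length_cons,
      Finset.sum_range_succ' (fun i => soloInformedGQ (soloInformedInsQ Y p (q :: t) i)),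
      Finset.sum_range_succ' (fun i => soloInformedGQ (soloInformedMergeQ Y (q :: t) i)),
      Finset.sum_congr rfl fun i _ => eI i, Finset.sum_congr rfl eM, ← Finset.mul_sum,
      ← Finset.mul_sum]
    have key : q / (1 - q) * ∑ i ∈ Finset.range (t.length + 1), soloInformedGQ (soloInformedInsQ Y q t i) +
        q / (1 - q) * ∑ i ∈ Finset.range t.length, soloInformedGQ (soloInformedMergeQ Y t i) =
        q / (1 - q) * (1 / (1 - Y) * soloInformedGQ t +
          (q * Y / (1 - q * Y) - Y / (1 - Y)) * soloInformedGQ (t.map (· * Y))) := by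
      rw [← mul_add, ih]
    have eq0 : q / (1 - q) * ∑ i ∈ Finset.range (t.length + 1), soloInformedGQ (soloInformedInsQ Y q t i) +
        soloInformedGQ (soloInformedInsQ Y p (q :: t) 0) +
        (q / (1 - q) * ∑ i ∈ Finset.range t.length, soloInformedGQ (soloInformedMergeQ Y t i) +
          soloInformedGQ (soloInformedMergeQ Y (q :: t) 0)) =
        q / (1 - q) * (1 / (1 - Y) * soloInformedGQ t +
          (q * Y / (1 - q * Y) - Y / (1 - Y)) * soloInformedGQ (t.map (· * Y))) +
        soloInformedGQ (soloInformedInsQ Y p (q :: t) 0) + soloInformedGQ (soloInformedMergeQ Y (q :: t) 0) := by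
      rw [← key]
      ring
    rw [eq0, soloInformedInsQ_zero, soloInformedMergeQ_zero, List.map_cons, soloInformedGQ_cons_cons]
    cases t with
    | nil =>
      simp only [List.map_nil, soloInformedGQ_single, soloInformedGQ_nil]
      field_simp
      ring
    | cons q' t' =>
      simp only [List.map_cons, soloInformedGQ_cons_cons]
      field_simp
      ring

/-- **THE HARMONIC-PRODUCT IDENTITY.** For `0 ≤ Y < 1` and a chain `Q` with `0 ≤ Q_r < 1`,

  `Σ_{i=0}^{k} G(ins_i(Y; Q)) + Σ_{i=0}^{k-1} G(merge_i(Y; Q)) = G(Q)/(1 − Y)`.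

[Hoffman 1997, §2 (A3) with a one-letter factor] -/
theorem soloInformed_harmonicGQ (Q : List ℝ) (hQ : ∀ q ∈ Q, 0 ≤ q ∧ q < 1) :
    (∑ i ∈ Finset.range (Q.length + 1), soloInformedGQ (soloInformedInsQ Y 1 Q i)) +
        ∑ i ∈ Finset.range Q.length, soloInformedGQ (soloInformedMergeQ Y Q i) =
      1 / (1 - Y) * soloInformedGQ Q := by
  rw [soloInformed_harmonicGQ_aux hY Q 1 hQ zero_le_one le_rfl, one_mul, sub_self, zero_mul, add_zero]

end identity

/-! ## 4. Sanity checks -/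

/-- Depth one: `1/((1−Y)(1−q)) = G(Y, qY) + G(q, qY) + G(qY)`, the three-term identity of
THEOREM XLI (`ζ(a)ζ(b) = ζ(a,b) + ζ(b,a) + ζ(a+b)`). -/
example {Y q : ℝ} (hY : 0 ≤ Y ∧ Y < 1) (hq : 0 ≤ q ∧ q < 1) :
    soloInformedGQ [Y, q * Y] + soloInformedGQ [q, q * Y] + soloInformedGQ [q * Y] =
      1 / (1 - Y) * soloInformedGQ [q] := by
  have h := soloInformed_harmonicGQ hY [q] (by simpa using hq)
  simp only [List.length_singleton, Finset.sum_range_succ, Finset.sum_range_zero, zero_add,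
    soloInformedInsQ_zero, one_mul, List.map_cons, List.map_nil, soloInformedInsQ_cons_succ,
    soloInformedMergeQ_zero] at h
  simpa [add_assoc, add_comm, add_left_comm] using h

end Summit.KontsevichZagierPeriods.KontsevichZagierPeriods.Theorems
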